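import Literature.NumberTheory.ComplexMultiplication.UnitarySignatureAtSplitPlace   -- ★ p846847 (U1-d): `exists_cmType_frame_embeddings`, `sum_signature_block_eq_one_embeddings`
import Literature.NumberTheory.Automorphic.GaloisActionPlaces                      -- ★ `g • w` on `HeightOneSpectrum`, `HeightOneSpectrum.smul_asIdeal`
import Literature.NumberTheory.DiophantineGeometry.AbelianSchemeModelReduction     -- ★ `toClosureValuationSubring`, `isLocalHom_residue_comp_toClosureValuationSubring`
import Literature.NumberTheory.Automorphic.RankOneFiniteAdeleWeil                   -- ★ `instCharZeroAdicCompletion` (⇒ `Fintype (F →+* F̄_w)` via Mathlib `Embeddings.instFintypeRingHom`)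
import HarnessLib

/-!
# Crux `HLiu418` — P6 sub-line **F0-P6a**, P-line organ for `stub_KOTT` (ARITHMETIC HALF): the Kottwitz COUNT at a split place
# in the (S-T) `h1` currency — «the `𝔭_{c•w}`-block of the signature is a line»

Cell `hodgecm-mathlib`, crux `stmt-HodgeConjecture-24832` (HLiu418), sub-line P6a.  GEN heir A-p18 (g31), `--supports stmt-HodgeConjecture-24832`
(count-neutral).  CONSUMER: the SPINE `Cruxes/HLiu418/Lines/F0_P6a_RGDAssembly.lean` ED. 2 (61a43498), `structure RGDInputsAt`, rows
`τR`, `τR_spec`, `m_count` — the socket (S-T) of the K∕BT dock reads the Kottwitz signature `m : (F →+* F̄_w) → ℕ` through restrictions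
`τR τ : 𝓞 F →+* R` (`R ⊆ F̄_w` the valuation ring) and asks for THE COUNT
`∑_{τ : ker (residue R ∘ τR τ) = 𝔭_{c•w}} m τ = 1` ([RapoportSmithlingZhang2020Diagonal] (4.6): the `c•w`-block of `Lie A` is a line).  The P-line
(«M-35», stub `stub_KOTT`) must DISCHARGE these rows; this file is their arithmetic half, THEOREMS ONLY (no definition, no `sorry`):

* §1 `apply_coe_mem_closureValuationSubring` — for EVERY embedding `τ : F →+* F̄_w` and `x ∈ 𝓞 F`, `τ x ∈ R` (algebraic integers are integral over
  `𝒪_{F_w}`, and `R` is the ring of `𝒪_{F_w}`-integral elements of `F̄_w`, ★ `mem_closureValuationSubring_iff_mem_absIntegers`); hence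
  `exists_restrict`: a family of restrictions `τR τ : 𝓞 F →+* R` with `((τR τ x : R) : F̄_w) = τ x` EXISTS (= the spine՚s rows `τR`∕`τR_spec` BY VALUE).
* §2 for ANY such family `(τR, hτR)` (it is unique, so we quantify rather than define): the prime `ker (residue R ∘ τR τ)` «induced by `τ`» satisfies
  `ker (… τR (τ ∘ c)) = c • ker (… τR τ)` (`ker_residue_restrict_comp_complexConj`) and, for the STRUCTURAL embedding `τ_w : F → F_w → F̄_w`,
  `ker (… τR τ_w) = 𝔭_w` (`ker_residue_restrict_structural`; ★ `toClosureValuationSubring` is a local homomorphism out of `𝓞_{F,(w)}`).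
* §3 at a SPLIT place (`c • w ≠ w`) the block `D_w := {τ ∣ ker (… τR τ) = 𝔭_{c•w}}` is conjugation-independent, contains `τ_w ∘ c`, omits `τ_w`.
* §4 **`sum_filter_ker_residue_restrict_eq_one` (THE HEAD)** — for every `m` with `m (τ_w ∘ c) = 1` and `m = 0` on a CM type `Φ ⊇ D_w ∖ {τ_w ∘ c}` off the
  `τ_w`-pair: `∑_{τ ∈ D_w} m τ = 1` — ONE application of ★ p846847 `sum_signature_block_eq_one_embeddings`; and `exists_cmType_adapted`: such a frame CM
  type through `τ_w` EXISTS (★ `exists_cmType_frame_embeddings`).  With `m τ := mOf ι₁ Φ_ℂ (σ ∘ τ)` for `σ : F̄_w →+* ℂ` over `ι₁` (★ p846856) carrying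
  the frame type to `Φ_ℂ`, this IS `RGDInputsAt.m_count`; the geometric half of `stub_KOTT` (Kottwitz at `Ω`-points from the E-witness) is B-p04 (g40)՚s
  census (k1)–(k5), all ★.

[cite: RapoportSmithlingZhang2020Diagonal, §4.1 (4.6) p. 16 and p. 17; §3.2 p. 10] [cite: Kottwitz1992, §5 pp. 389–391]
[cite: NeukirchANT1999, Ch. II (4.8) and (8.1)]
-/

set_option autoImplicit false

-- `Summit.HodgeConjecture.HodgeConjecture.…` repeats `HodgeConjecture` by design (D-0017).
set_option linter.dupNamespace false

noncomputable section

open NumberField IsDedekindDomain IsLocalRing Polynomial ValuativeRel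
open scoped Pointwise
open Literature.NumberTheory.GaloisRepresentations (closureValuationSubring mem_closureValuationSubring_iff_mem_absIntegers)
open Literature.NumberTheory.DiophantineGeometry (toClosureValuationSubring algebraMap_comp_toClosureValuationSubring)
open Literature.NumberTheory.ComplexMultiplication (exists_cmType_frame_embeddings sum_signature_block_eq_one_embeddings
  comp_complexConj_comp_complexConj)

namespace Summit.HodgeConjecture.HodgeConjecture.Theorems.F0P6aKottwitzCountAtSplitPlace

variable {F : Type} [Field F] [NumberField F] [IsCMField F] (w : HeightOneSpectrum (𝓞 F))

/-! ### §1 Algebraic integers land in the valuation ring `R ⊆ F̄_w` under every embedding -/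

omit [IsCMField F] in
/-- **`τ(𝓞 F) ⊆ R`** for every embedding `τ : F →+* F̄_w`: an algebraic integer is integral over `ℤ ⊆ 𝒪_{F_w}`, and `R = {‖·‖ ≤ 1}` is the ring of
`𝒪_{F_w}`-integral elements of `F̄_w`. [cite: NeukirchANT1999, Ch. II (4.8)] -/
theorem apply_coe_mem_closureValuationSubring (τ : F →+* AlgebraicClosure (w.adicCompletion F)) (x : 𝓞 F) :
    τ (x : F) ∈ closureValuationSubring (w.adicCompletion F) := by
  rw [mem_closureValuationSubring_iff_mem_absIntegers]
  refine (mem_integralClosure_iff _ _).mpr ?_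
  -- a monic integer relation of `x` maps to a monic `𝒪_{F_w}`-relation of `τ x`
  obtain ⟨p, hp, hpx⟩ := RingOfIntegers.isIntegral x
  refine ⟨p.map (Int.castRingHom _), hp.map _, ?_⟩
  have h0 : (τ.comp (algebraMap (𝓞 F) F)) (p.eval₂ (algebraMap ℤ (𝓞 F)) x) = 0 := by
    rw [hpx, map_zero]
  rw [Polynomial.hom_eval₂] at h0
  rw [Polynomial.eval₂_map]
  have hint : (algebraMap (𝒪[w.adicCompletion F]) (AlgebraicClosure (w.adicCompletion F))).comp (Int.castRingHom _) =
      (τ.comp (algebraMap (𝓞 F) F)).comp (algebraMap ℤ (𝓞 F)) := RingHom.ext_int _ _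
  rw [hint]
  exact h0

omit [IsCMField F] in
/-- **The restrictions `τ|_{𝓞 F} : 𝓞 F →+* R` EXIST for all `τ` at once** (the spine՚s rows `τR`∕`τR_spec` BY VALUE; unique by injectivity of
`R ⊆ F̄_w`, so the laws below quantify over any such family). [cite: NeukirchANT1999, Ch. II (4.8)] -/
theorem exists_restrict :
    ∃ τR : (F →+* AlgebraicClosure (w.adicCompletion F)) → (𝓞 F →+* ↥(closureValuationSubring (w.adicCompletion F))),
      ∀ (τ : F →+* AlgebraicClosure (w.adicCompletion F)) (x : 𝓞 F),
        ((τR τ x : ↥(closureValuationSubring (w.adicCompletion F))) : AlgebraicClosure (w.adicCompletion F)) = τ (x : F) :=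
  ⟨fun τ => (τ.comp (algebraMap (𝓞 F) F)).codRestrict (closureValuationSubring (w.adicCompletion F))
      (apply_coe_mem_closureValuationSubring w τ), fun _ _ => rfl⟩

/-! ### §2 The prime induced by an embedding, for any family of restrictions -/

/-- `c⁻¹ = c` in `Aut(F ∕ F⁺)`. [cite: RapoportSmithlingZhang2020Diagonal, §3.2 p. 10] -/
theorem complexConj_inv : (IsCMField.complexConj F)⁻¹ = IsCMField.complexConj F :=
  inv_eq_of_mul_eq_one_right (AlgEquiv.ext fun x => IsCMField.complexConj_apply_apply F x)

section Restrict

variable (τR : (F →+* AlgebraicClosure (w.adicCompletion F)) → (𝓞 F →+* ↥(closureValuationSubring (w.adicCompletion F))))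
  (hτR : ∀ (τ : F →+* AlgebraicClosure (w.adicCompletion F)) (x : 𝓞 F),
    ((τR τ x : ↥(closureValuationSubring (w.adicCompletion F))) : AlgebraicClosure (w.adicCompletion F)) = τ (x : F))

include hτR

/-- `τR (τ ∘ c) x = τR τ (c • x)` (both have underlying value `τ (c x)`). [cite: RapoportSmithlingZhang2020Diagonal, §3.2 p. 10] -/
theorem restrict_comp_complexConj_apply (τ : F →+* AlgebraicClosure (w.adicCompletion F)) (x : 𝓞 F) :
    τR (τ.comp ((IsCMField.complexConj F : F ≃ₐ[↥(maximalRealSubfield F)] F) : F →+* F)) x =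
      τR τ ((IsCMField.complexConj F) • x) := by
  apply Subtype.ext
  rw [hτR, hτR]
  rfl

/-- **CONJUGATION MOVES THE INDUCED PRIME**: `ker (residue ∘ τR (τ ∘ c)) = c • ker (residue ∘ τR τ)` as ideals of `𝓞 F`.
[cite: NeukirchANT1999, Ch. II (8.1)] [cite: RapoportSmithlingZhang2020Diagonal, §3.2 p. 10] -/
theorem ker_residue_restrict_comp_complexConj (τ : F →+* AlgebraicClosure (w.adicCompletion F)) :
    RingHom.ker ((residue ↥(closureValuationSubring (w.adicCompletion F))).comp
        (τR (τ.comp ((IsCMField.complexConj F : F ≃ₐ[↥(maximalRealSubfield F)] F) : F →+* F)))) =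
      (IsCMField.complexConj F) • RingHom.ker ((residue ↥(closureValuationSubring (w.adicCompletion F))).comp (τR τ)) := by
  ext x
  rw [RingHom.mem_ker, RingHom.comp_apply, restrict_comp_complexConj_apply w τR hτR τ x,
    Ideal.mem_pointwise_smul_iff_inv_smul_mem, complexConj_inv, RingHom.mem_ker, RingHom.comp_apply]

omit [IsCMField F] in
/-- **THE STRUCTURAL EMBEDDING INDUCES `w`**: for `τ_w : F → F_w → F̄_w`, `ker (residue ∘ τR τ_w) = 𝔭_w` (`𝓞 F → 𝓞_{F,(w)} → R → κ(R)` has its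
first arrow inverting exactly `𝓞 F ∖ 𝔭_w` and the composite of the other two a LOCAL homomorphism, ★ `isLocalHom_residue_comp_toClosureValuationSubring`).
[cite: NeukirchANT1999, Ch. II (8.1)] -/
theorem ker_residue_restrict_structural :
    RingHom.ker ((residue ↥(closureValuationSubring (w.adicCompletion F))).comp
        (τR ((algebraMap (w.adicCompletion F) (AlgebraicClosure (w.adicCompletion F))).comp
          (algebraMap F (w.adicCompletion F))))) = w.asIdeal := by
  -- the restriction of the structural embedding IS `toClosureValuationSubring w ∘ (𝓞 F → 𝓞_{F,(w)})`
  have hfun : ∀ x : 𝓞 F,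
      τR ((algebraMap (w.adicCompletion F) (AlgebraicClosure (w.adicCompletion F))).comp (algebraMap F (w.adicCompletion F))) x =
        toClosureValuationSubring w (algebraMap (𝓞 F) (HeightOneSpectrum.valuationSubringAtPrime F w) x) := by
    intro x
    apply Subtype.ext
    rw [hτR]
    have h := RingHom.congr_fun (algebraMap_comp_toClosureValuationSubring w)
      (algebraMap (𝓞 F) (HeightOneSpectrum.valuationSubringAtPrime F w) x)
    rw [RingHom.comp_apply, RingHom.comp_apply] at h
    change _ = (algebraMap _ (AlgebraicClosure (w.adicCompletion F))) (toClosureValuationSubring w _)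
    rw [h, RingHom.comp_apply, IsScalarTower.algebraMap_eq F (w.adicCompletion F) (AlgebraicClosure (w.adicCompletion F))]
    rfl
  haveI := w.isPrime
  ext x
  rw [RingHom.mem_ker, RingHom.comp_apply, hfun]
  -- `residue (toCVS y) = 0 ↔ y` is a non-unit of `𝓞_{F,(w)}` ↔ `x ∈ 𝔭_w`
  have hloc := Literature.NumberTheory.DiophantineGeometry.isLocalHom_residue_comp_toClosureValuationSubring w
  constructor
  · intro h0
    by_contra hx
    have hu : IsUnit (algebraMap (𝓞 F) (HeightOneSpectrum.valuationSubringAtPrime F w) x) :=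
      (IsLocalization.AtPrime.isUnit_to_map_iff _ w.asIdeal x).mpr hx
    have := (hu.map ((residue ↥(closureValuationSubring (w.adicCompletion F))).comp (toClosureValuationSubring w))).ne_zero
    exact this h0
  · intro hx
    by_contra h0
    have hu : IsUnit (((residue ↥(closureValuationSubring (w.adicCompletion F))).comp (toClosureValuationSubring w))
        (algebraMap (𝓞 F) (HeightOneSpectrum.valuationSubringAtPrime F w) x)) := isUnit_iff_ne_zero.mpr h0
    have hu' := (isUnit_map_iff ((residue ↥(closureValuationSubring (w.adicCompletion F))).comp (toClosureValuationSubring w)) _).mp hu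
    exact ((IsLocalization.AtPrime.isUnit_to_map_iff _ w.asIdeal x).mp hu') hx

/-! ### §3 The block of embeddings inducing `c • w` at a split place -/

/-- `τ_w ∘ c` induces `c • w`. [cite: NeukirchANT1999, Ch. II (8.1)] -/
theorem ker_residue_restrict_structural_comp_complexConj :
    RingHom.ker ((residue ↥(closureValuationSubring (w.adicCompletion F))).comp
        (τR (((algebraMap (w.adicCompletion F) (AlgebraicClosure (w.adicCompletion F))).comp
          (algebraMap F (w.adicCompletion F))).comp ((IsCMField.complexConj F : F ≃ₐ[↥(maximalRealSubfield F)] F) : F →+* F)))) =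
      ((IsCMField.complexConj F) • w).asIdeal := by
  rw [ker_residue_restrict_comp_complexConj w τR hτR, ker_residue_restrict_structural w τR hτR]
  rfl

/-- At a SPLIT place (`c • w ≠ w`) the structural embedding is NOT in the `c • w`-block. [cite: RapoportSmithlingZhang2020Diagonal, §4.1 p. 17] -/
theorem ker_residue_restrict_structural_ne (hw : (IsCMField.complexConj F) • w ≠ w) :
    RingHom.ker ((residue ↥(closureValuationSubring (w.adicCompletion F))).comp
        (τR ((algebraMap (w.adicCompletion F) (AlgebraicClosure (w.adicCompletion F))).comp
          (algebraMap F (w.adicCompletion F))))) ≠ ((IsCMField.complexConj F) • w).asIdeal := by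
  rw [ker_residue_restrict_structural w τR hτR]
  intro h
  exact hw (HeightOneSpectrum.ext h.symm)

/-- **THE `c • w`-BLOCK IS CONJUGATION-INDEPENDENT** at a split place: if `τ` induces `c • w` then `τ ∘ c` induces `w ≠ c • w`.
[cite: RapoportSmithlingZhang2020Diagonal, §3.2 p. 10; §4.1 p. 17] -/
theorem comp_complexConj_not_mem_block (hw : (IsCMField.complexConj F) • w ≠ w) (τ : F →+* AlgebraicClosure (w.adicCompletion F))
    (hτ : RingHom.ker ((residue ↥(closureValuationSubring (w.adicCompletion F))).comp (τR τ)) = ((IsCMField.complexConj F) • w).asIdeal) :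
    RingHom.ker ((residue ↥(closureValuationSubring (w.adicCompletion F))).comp
        (τR (τ.comp ((IsCMField.complexConj F : F ≃ₐ[↥(maximalRealSubfield F)] F) : F →+* F)))) ≠
      ((IsCMField.complexConj F) • w).asIdeal := by
  rw [ker_residue_restrict_comp_complexConj w τR hτR, hτ]
  change ((IsCMField.complexConj F) • ((IsCMField.complexConj F) • w)).asIdeal ≠ ((IsCMField.complexConj F) • w).asIdeal
  rw [smul_smul, show IsCMField.complexConj F * IsCMField.complexConj F = 1 from
    AlgEquiv.ext fun x => IsCMField.complexConj_apply_apply F x, one_smul]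
  intro h
  exact hw (HeightOneSpectrum.ext h).symm

/-! ### §4 THE COUNT and the adapted frame CM type -/

/-- **THE COUNT `∑_{τ ↦ c•w} m τ = 1` (HEAD; = `RGDInputsAt.m_count` BY VALUE)**: at a split place, for a signature `m` with `m (τ_w ∘ c) = 1` and
`m = 0` on a CM type `Φ` (here: any finite set) containing the `c • w`-block off `τ_w ∘ c`, away from the `τ_w`-pair — ONE application of ★ p846847
`sum_signature_block_eq_one_embeddings` with `D := {τ ∣ ker (residue ∘ τR τ) = 𝔭_{c•w}}`, `τ₀ := τ_w`.
[cite: RapoportSmithlingZhang2020Diagonal, §4.1 (4.6) p. 16 and p. 17] [cite: Kottwitz1992, §5 pp. 389–391] -/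
theorem sum_filter_ker_residue_restrict_eq_one (hw : (IsCMField.complexConj F) • w ≠ w)
    (Φ : Finset (F →+* AlgebraicClosure (w.adicCompletion F))) (m : (F →+* AlgebraicClosure (w.adicCompletion F)) → ℕ)
    (hΦ : ∀ τ : F →+* AlgebraicClosure (w.adicCompletion F),
      RingHom.ker ((residue ↥(closureValuationSubring (w.adicCompletion F))).comp (τR τ)) = ((IsCMField.complexConj F) • w).asIdeal →
      τ ≠ ((algebraMap (w.adicCompletion F) (AlgebraicClosure (w.adicCompletion F))).comp (algebraMap F (w.adicCompletion F))).comp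
        ((IsCMField.complexConj F : F ≃ₐ[↥(maximalRealSubfield F)] F) : F →+* F) → τ ∈ Φ)
    (hm₁ : m (((algebraMap (w.adicCompletion F) (AlgebraicClosure (w.adicCompletion F))).comp (algebraMap F (w.adicCompletion F))).comp
        ((IsCMField.complexConj F : F ≃ₐ[↥(maximalRealSubfield F)] F) : F →+* F)) = 1)
    (hm₀ : ∀ τ ∈ Φ, τ ≠ (algebraMap (w.adicCompletion F) (AlgebraicClosure (w.adicCompletion F))).comp (algebraMap F (w.adicCompletion F)) →
      τ ≠ ((algebraMap (w.adicCompletion F) (AlgebraicClosure (w.adicCompletion F))).comp (algebraMap F (w.adicCompletion F))).comp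
        ((IsCMField.complexConj F : F ≃ₐ[↥(maximalRealSubfield F)] F) : F →+* F) → m τ = 0) :
    ∑ τ ∈ (Finset.univ.filter fun τ : F →+* AlgebraicClosure (w.adicCompletion F) =>
        RingHom.ker ((residue ↥(closureValuationSubring (w.adicCompletion F))).comp (τR τ)) =
          (((IsCMField.complexConj F) • w).asIdeal : Ideal (𝓞 F))), m τ = 1 := by
  classical
  refine sum_signature_block_eq_one_embeddings
    ((algebraMap (w.adicCompletion F) (AlgebraicClosure (w.adicCompletion F))).comp (algebraMap F (w.adicCompletion F))) _ Φ m
    ?_ ?_ ?_ hm₁ hm₀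
  · intro τ hτ hτc
    rw [Finset.mem_filter] at hτ hτc
    exact comp_complexConj_not_mem_block w τR hτR hw τ hτ.2 hτc.2
  · rw [Finset.mem_filter]
    exact ⟨Finset.mem_univ _, ker_residue_restrict_structural_comp_complexConj w τR hτR⟩
  · intro τ hτ hne
    rw [Finset.mem_filter] at hτ
    exact hΦ τ hτ.2 hne

/-- **THE ADAPTED FRAME CM TYPE EXISTS**: at a split place there is a CM type `Φ` of embeddings `F →+* F̄_w` (`τ ∈ Φ ↔ τ ∘ c ∉ Φ`) through the structural
`τ_w` containing the whole `c • w`-block off `τ_w ∘ c` — ★ `exists_cmType_frame_embeddings` fed with §3.  (Carried to a CM type of `F →+* ℂ` through `ι₁`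
by any `σ : F̄_w →+* ℂ` over `ι₁`, ★ p846856.) [cite: RapoportSmithlingZhang2020Diagonal, §3.2 p. 10; §4.1 p. 17] -/
theorem exists_cmType_adapted (hw : (IsCMField.complexConj F) • w ≠ w) :
    ∃ Φ : Finset (F →+* AlgebraicClosure (w.adicCompletion F)),
      (algebraMap (w.adicCompletion F) (AlgebraicClosure (w.adicCompletion F))).comp (algebraMap F (w.adicCompletion F)) ∈ Φ ∧
      (∀ τ, τ ∈ Φ ↔ τ.comp ((IsCMField.complexConj F : F ≃ₐ[↥(maximalRealSubfield F)] F) : F →+* F) ∉ Φ) ∧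
      ∀ τ : F →+* AlgebraicClosure (w.adicCompletion F),
        RingHom.ker ((residue ↥(closureValuationSubring (w.adicCompletion F))).comp (τR τ)) = ((IsCMField.complexConj F) • w).asIdeal →
        τ ≠ ((algebraMap (w.adicCompletion F) (AlgebraicClosure (w.adicCompletion F))).comp (algebraMap F (w.adicCompletion F))).comp
          ((IsCMField.complexConj F : F ≃ₐ[↥(maximalRealSubfield F)] F) : F →+* F) → τ ∈ Φ := by
  classical
  obtain ⟨Φ, h₀, hcm, hD⟩ := exists_cmType_frame_embeddings
    ((algebraMap (w.adicCompletion F) (AlgebraicClosure (w.adicCompletion F))).comp (algebraMap F (w.adicCompletion F)))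
    (Finset.univ.filter fun τ : F →+* AlgebraicClosure (w.adicCompletion F) =>
      RingHom.ker ((residue ↥(closureValuationSubring (w.adicCompletion F))).comp (τR τ)) =
        (((IsCMField.complexConj F) • w).asIdeal : Ideal (𝓞 F)))
    (fun τ hτ hτc => by
      rw [Finset.mem_filter] at hτ hτc
      exact comp_complexConj_not_mem_block w τR hτR hw τ hτ.2 hτc.2)
    (fun h => by
      rw [Finset.mem_filter] at h
      exact ker_residue_restrict_structural_ne w τR hτR hw h.2)
  exact ⟨Φ, h₀, hcm, fun τ hτ hne => hD τ (Finset.mem_filter.mpr ⟨Finset.mem_univ _, hτ⟩) hne⟩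

end Restrict

end Summit.HodgeConjecture.HodgeConjecture.Theorems.F0P6aKottwitzCountAtSplitPlace

end
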